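import Mathlib.Analysis.Convex.SimplicialComplex.Basic
import Mathlib.Analysis.Convex.Combination
import Mathlib.Analysis.Convex.Topology
import Mathlib.Analysis.Normed.Module.FiniteDimension
import Mathlib.Analysis.Normed.Affine.AddTorsorBases
import Mathlib.LinearAlgebra.AffineSpace.FiniteDimensional
import Mathlib.LinearAlgebra.Basis.VectorSpace
import HarnessLib

/-!
# Transport of geometric simplicial complexes and purity

Two pieces of elementary PL topology for Mathlib's `Geometry.SimplicialComplex`:

* **Transport.** `exists_simplicialComplex_image`: if a map `φ` is injective on the underlying
  space of a complex `K` and agrees on each closed simplex with an affine map, the images of the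
  faces form a simplicial complex whose closed simplices are the images of those of `K`
  (Rourke–Sanderson (1972), Ch. 2: the image of a complex under a simplicial embedding).  The
  affine-independence step is `affineIndependent_image_of_injOn` (an affine map injective on a
  closed simplex is injective on its vertices *and* on balanced combinations — centroid
  argument).  `exists_affineMap_leftInverse` supplies affine left inverses of injective affine
  maps, so complexes can be pulled back along affine embeddings.  This strictly generalises the
  affine-equivalence special case `Literature.Topology.FourManifolds.exists_simplicialComplex_faces_iff_image`
  / `space_eq_image_of_faces_iff_image` of `PLManifoldProofs.lean` (take `φ := e`,
  `A := e.toAffineMap`); that one can be retired in favour of this.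
* **Purity.** `exists_subset_affineSpan_eq_top`: in a finite complex, every simplex whose closed
  simplex lies in the closure of the interior of the underlying space is a face of a
  top-dimensional simplex (the centroid of the simplex has a neighbourhood covered by the closed
  simplices containing it; a finite union of closed sets with empty interior has empty
  interior).

All statements are standard; no named facts are introduced. [folklore]
-/

open Set Function

noncomputable section

namespace Literature.Analysis.Convexity

/-! ### Centroids and relative interiors of simplices -/

section Centroid

variable {E : Type*} [AddCommGroup E] [Module ℝ E]

/-- The centroid (barycentre of the vertices) of a finite configuration, as the explicit sum
`∑ v ∈ t, (#t)⁻¹ • v`.  For nonempty `t` this *is* Mathlib's `t.centroid ℝ id`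
(`bary_eq_centroid`); we keep a separate name only because the explicit sum form (with value `0`
on `∅`, where Mathlib's centroid is a junk affine combination) is what the weight computations of
the subdivision theory (`Literature.Analysis.Convexity.StandardExtension`) manipulate.
[folklore] -/
def bary (t : Finset E) : E := ∑ v ∈ t, (t.card : ℝ)⁻¹ • v

/-- Bridge to Mathlib: for nonempty `t`, `bary t` is the centroid `t.centroid ℝ id`.
[folklore] -/
theorem bary_eq_centroid {t : Finset E} (ht : t.Nonempty) : bary t = t.centroid ℝ id := by
  rw [Finset.centroid_eq_centerMass _ ht,
    Finset.centerMass_eq_of_sum_1 _ _ (t.sum_centroidWeights_eq_one_of_nonempty ℝ ht)]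
  simp [bary, Finset.centroidWeights_apply]

/-- The centroid lies in the convex hull (Mathlib's `Finset.centroid_mem_convexHull` through the
bridge `bary_eq_centroid`). [folklore] -/
theorem bary_mem_convexHull {t : Finset E} (ht : t.Nonempty) : bary t ∈ convexHull ℝ (t : Set E) := by
  rw [bary_eq_centroid ht]
  exact t.centroid_mem_convexHull ht

/-- **The centroid is a relative-interior point:** it does not lie in the convex hull of a proper
subset of the (affinely independent) vertex set. [folklore] -/
theorem bary_notMem_convexHull_of_ssubset {t r : Finset E}
    (ht : AffineIndependent ℝ ((↑) : t → E)) (hrt : r ⊂ t) :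
    bary t ∉ convexHull ℝ (r : Set E) := by
  classical
  intro hmem
  obtain ⟨w, hw0, hw1, hwc⟩ := Finset.mem_convexHull'.1 hmem
  obtain ⟨u, hut, hur⟩ := Finset.exists_of_ssubset hrt
  have hk : (0 : ℝ) < t.card := by exact_mod_cast (Finset.card_pos.2 ⟨u, hut⟩)
  -- extend the weights by zero and compare with the uniform weights
  set w' : E → ℝ := fun v => if v ∈ r then w v else 0 with hw'
  have hsum' : ∑ v ∈ t, w' v = ∑ v ∈ t, (fun _ => (t.card : ℝ)⁻¹) v := by
    rw [Finset.sum_const, nsmul_eq_mul, mul_inv_cancel₀ hk.ne']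
    rw [← Finset.sum_subset hrt.1 (fun v _ hv => by simp [hw', hv])]
    rw [← hw1]
    exact Finset.sum_congr rfl fun v hv => by simp [hw', hv]
  have hcomb' : ∑ v ∈ t, w' v • v = ∑ v ∈ t, (t.card : ℝ)⁻¹ • v := by
    rw [← Finset.sum_subset hrt.1 (fun v _ hv => by simp [hw', hv])]
    have : ∑ v ∈ r, w' v • v = ∑ v ∈ r, w v • v := Finset.sum_congr rfl fun v hv => by
      simp [hw', hv]
    rw [this, hwc]
    rfl
  have := ht.eq_of_sum_eq_sum_subtype hsum' hcomb' u hut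
  simp only [hw', if_neg hur] at this
  exact (inv_pos.2 hk).ne this

/-- Along a balanced direction the centroid can be moved inside the simplex: if `∑ v ∈ t, c v = 0`
then `bary t + τ • ∑ c v • v ∈ convexHull t` for all small `τ ≥ 0`. [folklore] -/
theorem bary_add_smul_mem_convexHull {t : Finset E} (ht : t.Nonempty) {c : E → ℝ}
    (hc : ∑ v ∈ t, c v = 0) {τ : ℝ} (hτ0 : 0 ≤ τ) (hτ : ∀ v ∈ t, τ * |c v| ≤ (t.card : ℝ)⁻¹) :
    bary t + τ • ∑ v ∈ t, c v • v ∈ convexHull ℝ (t : Set E) := by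
  have hk : (0 : ℝ) < t.card := by exact_mod_cast ht.card_pos
  have heq : bary t + τ • ∑ v ∈ t, c v • v = ∑ v ∈ t, ((t.card : ℝ)⁻¹ + τ * c v) • v := by
    simp only [bary, add_smul, Finset.sum_add_distrib, Finset.smul_sum, smul_smul]
  rw [heq]
  refine (convex_convexHull ℝ _).sum_mem (fun v hv => ?_) ?_ fun v hv => subset_convexHull ℝ _ hv
  · have h1 := hτ v hv
    have h2 : -(τ * |c v|) ≤ τ * c v := by
      rw [← mul_neg]; exact mul_le_mul_of_nonneg_left (neg_abs_le _) hτ0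
    linarith
  · rw [Finset.sum_add_distrib, Finset.sum_const, nsmul_eq_mul, mul_inv_cancel₀ hk.ne',
      ← Finset.mul_sum, hc, mul_zero, add_zero]

end Centroid

/-! ### Affine maps injective on a simplex -/

section Injective

variable {E F : Type*} [AddCommGroup E] [Module ℝ E] [AddCommGroup F] [Module ℝ F]

/-- An affine map injective on the closed simplex of an affinely independent configuration `t`
kills no nonzero balanced combination of the vertices. [folklore] -/
theorem eq_zero_of_linear_sum_smul_eq_zero_of_injOn {t : Finset E}
    (ht : AffineIndependent ℝ ((↑) : t → E))
    (A : E →ᵃ[ℝ] F) (hA : InjOn A (convexHull ℝ (t : Set E))) {c : E → ℝ} (hc : ∑ v ∈ t, c v = 0)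
    (hcA : A.linear (∑ v ∈ t, c v • v) = 0) : ∀ v ∈ t, c v = 0 := by
  classical
  rcases t.eq_empty_or_nonempty with rfl | hne
  · simp
  -- move the centroid along the balanced direction
  set u : E := ∑ v ∈ t, c v • v with hu
  obtain ⟨τ, hτ0, hτ⟩ : ∃ τ : ℝ, 0 < τ ∧ ∀ v ∈ t, τ * |c v| ≤ (t.card : ℝ)⁻¹ := by
    have hk : (0 : ℝ) < t.card := by exact_mod_cast hne.card_pos
    set Cmax : ℝ := t.sup' hne fun v => |c v| with hCmax
    have hC : ∀ v ∈ t, |c v| ≤ Cmax := fun v hv => Finset.le_sup' (fun v => |c v|) hv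
    have hC0 : 0 ≤ Cmax := by
      obtain ⟨v, hv⟩ := hne
      exact (abs_nonneg _).trans (hC v hv)
    refine ⟨(t.card : ℝ)⁻¹ / (Cmax + 1), by positivity, fun v hv => ?_⟩
    calc (t.card : ℝ)⁻¹ / (Cmax + 1) * |c v| ≤ (t.card : ℝ)⁻¹ / (Cmax + 1) * (Cmax + 1) := by
          gcongr; linarith [hC v hv]
      _ = (t.card : ℝ)⁻¹ := by field_simp
  have hmem : bary t + τ • u ∈ convexHull ℝ (t : Set E) :=
    bary_add_smul_mem_convexHull hne hc hτ0.le hτ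
  have hfix : A (bary t + τ • u) = A (bary t) := by
    have : bary t + τ • u = (τ • u) +ᵥ bary t := by rw [vadd_eq_add, add_comm]
    rw [this, A.map_vadd, map_smul, hcA, smul_zero, zero_vadd]
  have hu0 : u = 0 := by
    have h := hA hmem (bary_mem_convexHull hne) hfix
    have : τ • u = 0 := by
      have h' := congrArg (fun z => z - bary t) h
      simpa using h'
    exact (smul_eq_zero.1 this).resolve_left hτ0.ne'
  exact ht.eq_zero_of_sum_eq_zero_subtype hc (by rw [← hu]; exact hu0)

/-- **Affine maps injective on a closed simplex preserve affine independence of its vertices.**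
[folklore] -/
theorem affineIndependent_image_of_injOn [DecidableEq F] {t : Finset E}
    (ht : AffineIndependent ℝ ((↑) : t → E)) (A : E →ᵃ[ℝ] F)
    (hA : InjOn A (convexHull ℝ (t : Set E))) :
    AffineIndependent ℝ ((↑) : ↥(t.image A) → F) := by
  classical
  rw [affineIndependent_iff_of_fintype]
  intro w hw0 hw1
  -- transfer the weights to `F` and then to `t`
  set W : F → ℝ := fun y => if h : y ∈ t.image A then w ⟨y, h⟩ else 0 with hW
  have hWw : ∀ i : ↥(t.image A), W i = w i := fun i => by
    simp only [hW, dif_pos i.2]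
  have hsumW : ∑ y ∈ t.image A, W y = 0 := by
    rw [← Finset.sum_coe_sort]
    simp_rw [hWw]
    exact hw0
  have hcombW : ∑ y ∈ t.image A, W y • y = 0 := by
    rw [Finset.weightedVSub_eq_linear_combination _ hw0] at hw1
    rw [← Finset.sum_coe_sort]
    simp_rw [hWw]
    exact hw1
  have hinjt : ∀ v ∈ t, ∀ v' ∈ t, A v = A v' → v = v' := fun v hv v' hv' h =>
    hA (subset_convexHull ℝ _ hv) (subset_convexHull ℝ _ hv') h
  set c : E → ℝ := fun v => W (A v) with hc
  have hc0 : ∑ v ∈ t, c v = 0 := by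
    rw [hc]
    rw [← Finset.sum_image (f := W) hinjt]
    exact hsumW
  have hcA : A.linear (∑ v ∈ t, c v • v) = 0 := by
    have h1 : ∑ v ∈ t, c v • A v = 0 := by
      rw [hc, ← Finset.sum_image (f := fun y => W y • y) hinjt]
      exact hcombW
    have h2 : ∑ v ∈ t, c v • A v = A.linear (∑ v ∈ t, c v • v) + (∑ v ∈ t, c v) • A 0 := by
      have hAv : ∀ v, A v = A.linear v + A 0 := fun v => by
        have := A.map_vadd 0 v
        rw [vadd_eq_add, add_zero] at this
        rw [this, vadd_eq_add]
      calc ∑ v ∈ t, c v • A v = ∑ v ∈ t, (c v • A.linear v + c v • A 0) :=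
            Finset.sum_congr rfl fun v _ => by rw [hAv v, smul_add]
        _ = A.linear (∑ v ∈ t, c v • v) + (∑ v ∈ t, c v) • A 0 := by
            rw [Finset.sum_add_distrib, ← Finset.sum_smul, map_sum]
            simp_rw [map_smul]
    rw [h2, hc0, zero_smul, add_zero] at h1
    exact h1
  have hcz := eq_zero_of_linear_sum_smul_eq_zero_of_injOn ht A hA hc0 hcA
  intro i
  obtain ⟨v, hv, hiv⟩ := Finset.mem_image.1 i.2
  rw [← hWw i, ← hiv]
  exact hcz v hv

end Injective

/-! ### Images of complexes -/

section Image

variable {E F : Type*} [AddCommGroup E] [Module ℝ E] [AddCommGroup F] [Module ℝ F]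

/-- **Transport of a simplicial complex along a simplexwise-affine injection.** Let `φ` be
injective on `K.space` and agree on each closed simplex of `K` with an affine map. Then there is
a simplicial complex whose faces are exactly the images `s.image φ` of the faces of `K`, and
`φ` maps each closed simplex of `K` onto the corresponding closed simplex. Rourke–Sanderson
(1972), Ch. 2. [folklore] -/
theorem exists_simplicialComplex_image [DecidableEq F] (K : Geometry.SimplicialComplex ℝ E)
    (φ : E → F) (hφ : ∀ s ∈ K.faces, ∃ A : E →ᵃ[ℝ] F, EqOn φ A (convexHull ℝ (s : Set E)))
    (hinj : InjOn φ K.space) :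
    ∃ K' : Geometry.SimplicialComplex ℝ F,
      (∀ t, t ∈ K'.faces ↔ ∃ s ∈ K.faces, s.image φ = t) ∧
      ∀ s ∈ K.faces, convexHull ℝ ((s.image φ : Finset F) : Set F) = φ '' convexHull ℝ (s : Set E) := by
  classical
  -- images of closed simplices
  have himg : ∀ s ∈ K.faces,
      convexHull ℝ ((s.image φ : Finset F) : Set F) = φ '' convexHull ℝ (s : Set E) := by
    intro s hs
    obtain ⟨A, hA⟩ := hφ s hs
    have h1 : (s.image φ : Set F) = A '' (s : Set E) := by
      rw [Finset.coe_image]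
      exact Set.image_congr fun v hv => hA (subset_convexHull ℝ _ hv)
    rw [h1, ← AffineMap.image_convexHull]
    exact (Set.image_congr hA).symm
  -- vertices in different faces with the same image coincide
  have hvinj : ∀ s ∈ K.faces, ∀ s' ∈ K.faces, ∀ v ∈ s, ∀ v' ∈ s', φ v = φ v' → v = v' :=
    fun s hs s' hs' v hv v' hv' h =>
      hinj (K.subset_space hs hv) (K.subset_space hs' hv') h
  refine ⟨{ faces := {t | ∃ s ∈ K.faces, s.image φ = t}
            isRelLowerSet_faces := ?_
            indep := ?_
            inter_subset_convexHull := ?_ }, fun t => Iff.rfl, himg⟩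
  · rintro _ ⟨s, hs, rfl⟩
    refine ⟨(K.nonempty_of_mem_faces hs).image φ, fun t ht htne => ?_⟩
    -- a nonempty subset of `s.image φ` is the image of a nonempty subset of `s`
    refine ⟨s.filter fun v => φ v ∈ t, K.down_closed hs (Finset.filter_subset _ _) ?_, ?_⟩
    · obtain ⟨y, hy⟩ := htne
      obtain ⟨v, hv, rfl⟩ := Finset.mem_image.1 (ht hy)
      exact ⟨v, Finset.mem_filter.2 ⟨hv, hy⟩⟩
    · ext y
      simp only [Finset.mem_image, Finset.mem_filter]
      constructor
      · rintro ⟨v, ⟨-, hvt⟩, rfl⟩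
        exact hvt
      · intro hy
        obtain ⟨v, hv, rfl⟩ := Finset.mem_image.1 (ht hy)
        exact ⟨v, ⟨hv, hy⟩, rfl⟩
  · rintro _ ⟨s, hs, rfl⟩
    obtain ⟨A, hA⟩ := hφ s hs
    have h1 : s.image φ = s.image A := Finset.image_congr fun v hv => hA (subset_convexHull ℝ _ hv)
    rw [h1]
    refine affineIndependent_image_of_injOn (K.indep hs) A fun x hx y hy hxy => ?_
    refine hinj (K.convexHull_subset_space hs hx) (K.convexHull_subset_space hs hy) ?_
    rw [hA hx, hA hy]
    exact hxy
  · rintro _ _ ⟨s, hs, rfl⟩ ⟨s', hs', rfl⟩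
    rw [himg s hs, himg s' hs']
    rintro y ⟨⟨x, hx, rfl⟩, ⟨x', hx', hxx'⟩⟩
    have hxeq : x' = x :=
      hinj (K.convexHull_subset_space hs' hx') (K.convexHull_subset_space hs hx) hxx'
    subst hxeq
    have hxi : x' ∈ convexHull ℝ (↑(s ∩ s') : Set E) := by
      rw [Finset.coe_inter]
      exact K.inter_subset_convexHull hs hs' ⟨hx, hx'⟩
    -- `s ∩ s'` is a face (if nonempty) whose image is the intersection of the images
    have hne : (s ∩ s').Nonempty := by
      by_contra h
      rw [Finset.not_nonempty_iff_eq_empty] at h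
      rw [h] at hxi
      simp at hxi
    have hface : s ∩ s' ∈ K.faces := K.down_closed hs Finset.inter_subset_left hne
    have himg' : ((s ∩ s').image φ : Set F) = ↑(s.image φ) ∩ ↑(s'.image φ) := by
      ext z
      simp only [Finset.coe_image, Finset.coe_inter, Set.mem_image, Set.mem_inter_iff,
        Finset.mem_coe]
      constructor
      · rintro ⟨v, ⟨hv, hv'⟩, rfl⟩
        exact ⟨⟨v, hv, rfl⟩, ⟨v, hv', rfl⟩⟩
      · rintro ⟨⟨v, hv, rfl⟩, ⟨v', hv', hvv'⟩⟩
        have := hvinj s' hs' s hs v' hv' v hv hvv'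
        subst this
        exact ⟨v', ⟨hv, hv'⟩, rfl⟩
    rw [← himg', himg _ hface]
    exact ⟨x', hxi, rfl⟩

end Image

/-! ### Affine left inverses -/

section LeftInverse

variable {E F : Type*} [AddCommGroup E] [Module ℝ E] [AddCommGroup F] [Module ℝ F]

/-- An injective affine map between real vector spaces has an affine left inverse. [folklore] -/
theorem exists_affineMap_leftInverse (α : E →ᵃ[ℝ] F) (hα : Injective α) :
    ∃ β : F →ᵃ[ℝ] E, ∀ x, β (α x) = x := by
  have hlin : Injective α.linear := α.linear_injective_iff.2 hα
  obtain ⟨L, hL⟩ := α.linear.exists_leftInverse_of_injective (LinearMap.ker_eq_bot.2 hlin)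
  refine ⟨L.toAffineMap + AffineMap.const ℝ F (-L (α 0)), fun x => ?_⟩
  have h1 : α x = α.linear x + α 0 := by
    have := α.map_vadd 0 x
    rw [vadd_eq_add, add_zero] at this
    rw [this, vadd_eq_add]
  have h2 : ∀ y, (L.toAffineMap + AffineMap.const ℝ F (-L (α 0))) y = L y + -L (α 0) := fun y => rfl
  have hLx : L (α.linear x) = x := by
    have := LinearMap.congr_fun hL x
    simpa using this
  rw [h2, h1, map_add, hLx]
  abel

end LeftInverse

/-! ### Purity -/

section Purity

variable {E : Type*} [NormedAddCommGroup E] [NormedSpace ℝ E]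

/-- A finite union of closed sets with empty interior has empty interior.  Same statement and
proof as `Literature.ModelTheory.ExponentialFields.interior_biUnion_finset_eq_empty`
(`Literature/ModelTheory/ExponentialFields/SemialgebraicInterior.lean`), which a convexity file
should not import; librarian: hoist both to a `Literature/Topology` file and dedupe. [folklore] -/
theorem interior_biUnion_finset_eq_empty {α ι : Type*} [TopologicalSpace α] (I : Finset ι)
    (A : ι → Set α) (hcl : ∀ i ∈ I, IsClosed (A i)) (hint : ∀ i ∈ I, interior (A i) = ∅) :
    interior (⋃ i ∈ I, A i) = ∅ := by
  classical
  induction I using Finset.induction_on with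
  | empty => simp
  | @insert a I haI ih =>
    rw [Finset.set_biUnion_insert, Set.union_comm,
      interior_union_isClosed_of_interior_empty ?_ (hint a (Finset.mem_insert_self a I))]
    · exact ih (fun i hi => hcl i (Finset.mem_insert_of_mem hi))
        (fun i hi => hint i (Finset.mem_insert_of_mem hi))
    · exact isClosed_biUnion_finset fun i hi => hcl i (Finset.mem_insert_of_mem hi)

variable [FiniteDimensional ℝ E]

omit [FiniteDimensional ℝ E] in
/-- If the centroid of a simplex `t` of a complex lies in the closed simplex of `t'`, then `t`
is a face of `t'`. [folklore] -/
theorem subset_of_bary_mem_convexHull {K : Geometry.SimplicialComplex ℝ E} {t t' : Finset E}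
    (ht : t ∈ K.faces) (ht' : t' ∈ K.faces) (h : bary t ∈ convexHull ℝ (t' : Set E)) : t ⊆ t' := by
  classical
  have hne : t.Nonempty := K.nonempty_of_mem_faces ht
  have hmem : bary t ∈ convexHull ℝ (↑(t ∩ t') : Set E) := by
    rw [Finset.coe_inter]
    exact K.inter_subset_convexHull ht ht' ⟨bary_mem_convexHull hne, h⟩
  by_contra hnot
  have hss : t ∩ t' ⊂ t := Finset.ssubset_iff_subset_ne.2 ⟨Finset.inter_subset_left, fun heq =>
    hnot (heq ▸ Finset.inter_subset_right)⟩
  exact bary_notMem_convexHull_of_ssubset (K.indep ht) hss hmem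

/-- **Purity.** In a finite simplicial complex, a simplex whose closed simplex lies in the
closure of the interior of the underlying space is a face of a simplex affinely spanning the
whole space (so of dimension `dim E`). [folklore] -/
theorem exists_subset_affineSpan_eq_top {K : Geometry.SimplicialComplex ℝ E} (hfin : K.faces.Finite)
    {t : Finset E} (ht : t ∈ K.faces)
    (hcl : convexHull ℝ (t : Set E) ⊆ closure (interior K.space)) :
    ∃ t' ∈ K.faces, t ⊆ t' ∧ affineSpan ℝ (t' : Set E) = ⊤ := by
  classical
  have hne : t.Nonempty := K.nonempty_of_mem_faces ht
  set c : E := bary t with hc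
  have hcK : c ∈ closure (interior K.space) := hcl (bary_mem_convexHull hne)
  -- the closed simplices not containing `t` as a face stay away from `c`
  set Bad : Finset (Finset E) := hfin.toFinset.filter fun t' => ¬ t ⊆ t' with hBad
  set Good : Finset (Finset E) := hfin.toFinset.filter fun t' => t ⊆ t' with hGood
  have hcBad : c ∉ ⋃ t' ∈ Bad, convexHull ℝ (t' : Set E) := by
    simp only [Set.mem_iUnion, not_exists]
    intro t' ht' hct'
    rw [hBad, Finset.mem_filter, Set.Finite.mem_toFinset] at ht'
    exact ht'.2 (subset_of_bary_mem_convexHull ht ht'.1 hct')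
  have hclosed : IsClosed (⋃ t' ∈ Bad, convexHull ℝ (t' : Set E)) :=
    isClosed_biUnion_finset fun t' _ => t'.finite_toSet.isClosed_convexHull ℝ
  obtain ⟨r, hr, hball⟩ := Metric.isOpen_iff.1 hclosed.isOpen_compl c hcBad
  -- near `c`, the underlying space is covered by the good simplices
  have hcover : Metric.ball c r ∩ K.space ⊆ ⋃ t' ∈ Good, convexHull ℝ (t' : Set E) := by
    rintro x ⟨hxr, hxK⟩
    obtain ⟨t', ht', hxt'⟩ := Geometry.SimplicialComplex.mem_space_iff.1 hxK
    by_cases hgood : t ⊆ t'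
    · exact Set.mem_biUnion (Finset.mem_filter.2 ⟨hfin.mem_toFinset.2 ht', hgood⟩) hxt'
    · exfalso
      refine hball hxr (Set.mem_biUnion (Finset.mem_filter.2 ⟨hfin.mem_toFinset.2 ht', hgood⟩) hxt')
  -- the interior of the underlying space meets the ball, so some good simplex has interior
  have hmeet : (Metric.ball c r ∩ interior K.space).Nonempty :=
    mem_closure_iff_nhds.1 hcK _ (Metric.ball_mem_nhds c hr)
  have hopen : IsOpen (Metric.ball c r ∩ interior K.space) := Metric.isOpen_ball.inter isOpen_interior
  have hsub : Metric.ball c r ∩ interior K.space ⊆ interior (⋃ t' ∈ Good, convexHull ℝ (t' : Set E)) :=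
    interior_maximal (fun x hx => hcover ⟨hx.1, interior_subset hx.2⟩) hopen
  have hint : interior (⋃ t' ∈ Good, convexHull ℝ (t' : Set E)) ≠ ∅ :=
    Set.nonempty_iff_ne_empty.1 (hmeet.mono hsub)
  obtain ⟨t', ht'G, ht'int⟩ : ∃ t' ∈ Good, interior (convexHull ℝ (t' : Set E)) ≠ ∅ := by
    by_contra hcon
    push Not at hcon
    exact hint (interior_biUnion_finset_eq_empty Good (fun t' => convexHull ℝ (t' : Set E))
      (fun t' _ => t'.finite_toSet.isClosed_convexHull ℝ) hcon)
  rw [hGood, Finset.mem_filter, Set.Finite.mem_toFinset] at ht'G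
  exact ⟨t', ht'G.1, ht'G.2,
    interior_convexHull_nonempty_iff_affineSpan_eq_top.1 (Set.nonempty_iff_ne_empty.2 ht'int)⟩

/-- In particular such a simplex is a face of a simplex with `dim E + 1` vertices. [folklore] -/
theorem exists_subset_card_eq_finrank_add_one {K : Geometry.SimplicialComplex ℝ E}
    (hfin : K.faces.Finite) {t : Finset E} (ht : t ∈ K.faces)
    (hcl : convexHull ℝ (t : Set E) ⊆ closure (interior K.space)) :
    ∃ t' ∈ K.faces, t ⊆ t' ∧ t'.card = Module.finrank ℝ E + 1 := by
  obtain ⟨t', ht', htt', htop⟩ := exists_subset_affineSpan_eq_top hfin ht hcl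
  refine ⟨t', ht', htt', ?_⟩
  have h := (K.indep ht').affineSpan_eq_top_iff_card_eq_finrank_add_one.1 (by
    rwa [Subtype.range_coe])
  rwa [Fintype.card_coe] at h

end Purity

end Literature.Analysis.Convexity
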